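/-
Copyright: the b2b-balaban T⁴-continuum CRUX team, row NE7b OWNER lineage `t4-ne7b-p1` (gen 124). Project licence.
-/
import Summits.QuantumFields.BalabanUV.T4Continuum.Spine.NE7b.SupZdKernelInverseLipschitz

/-!
# KERNEL ALGEBRA ON `ℤ^d`, V: INVERSES OF KERNELS THAT AGREE ON AN `ℓ¹`-BALL AGREE UP TO AN EXPONENTIALLY SMALL MARGIN ERROR — for bounded
# kernels `A, B` with decaying one-sided inverses `N_A` (left), `N_B` (right) and `|B − A| ≤ ε` on pairs inside the ball `|c|₁, |c′|₁ ≤ R`: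
# `|N_A(b,b′) − N_B(b,b′)| ≤ C_N²K_ν(εK_ν + 2C_AK_{ν∕2}(e^{−(ν∕2)(R−|b|₁)} + e^{−(ν∕2)(R−|b′|₁)}))` — (228)'s weighted Lipschitz bound with the weight
# `ε + 2C_A(𝟙[|c|₁>R] + 𝟙[|c′|₁>R])` and the exponential tail outside a ball.  The TEMPLATE of the torus → `ℤ^d` identification for the
# `H + K` column: a transplanted torus coarse operator agrees with `T_K` on the bulk of its window, so its inverse is `e^{−(ν∕2)·margin}`-close
# to `N_K` at fixed `(b,b′)` (row NE7b, node U5c; (189)∕(191)∕(194)∕(228) BY NAME; [folklore])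

Cell `pub-balaban`, sub-cell `t4`, spine estimate NE7b (`T4WeightBudget.RelWeightBound`; the cell's OWN estimate — NOT PRINTED in
[Bałaban 1983–89], NOT PROVED).  Crux-route work under `Spine/NE7b/` by the row OWNER (`t4-ne7b-p1` gen 124, file (229)) under FREEZE
(0)'s crux-prover clause; NOTHING of Bałaban's is named as a Lean object, valued or asserted; no `T4Continuum/Support` leaf typed; no `def`,
no notation (`|c|₁` WRITTEN OUT as `Σ_i|c_i − 0_i|`); zero `sorry`; no road object (pure kernel algebra).  Imports (BY NAME): the OWNER's (228)
`…SupZdKernelInverseLipschitz` (`inverse_lipschitz`; through it (189) `summable_exp_l1`, `tsum_exp_l1_le`, (191) `natAbs_sub_comm_sum`, (194)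
`l1_triangle`), Mathlib's `Summable.mul_of_nonneg`, `Summable.tsum_mul_tsum`, `Summable.tsum_add`.

WHY (located).  The ADDENDUM's NEXT item (b) made quantitative at the `ℤ^d` end: (227) gives convergence of inverses from entrywise
convergence, (228) the weighted Lipschitz form; this file evaluates the weight a WINDOW produces — agreement `ε` on a ball of radius `R`
(for a transplanted torus operator, `ε` is the seam leakage of (196)∕(197)'s type and `R` the window radius minus a margin) and the crude
bound `2C_A` outside — so that a successor only has to supply, for the torus `H + K` coarse operators read through the window maps: (1)
uniform boundedness, (2) decaying inverses with uniform constants ((226), uniformly in the volume), (3) agreement with `T_K` on the ball.  The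
tail `Σ_{|c|₁>R}e^{−ν|b−c|₁} ≤ K_{ν∕2}e^{−(ν∕2)(R−|b|₁)}` spends half the rate on the distance to the complement of the ball (§1).

WHAT IS PROVED ([folklore]): §1 **`tail_exp_sum`**; §2 **`inverse_ball_rate`** (THE END: the displayed bound for all `b, b′`); §3 toy.

HONEST (what this is NOT).  Abstract; the torus side ((1)–(3) above) is NOT here; `ν∕2` is a convenience, not optimal; nothing of the
covariant propagators of [B4]–[B6]; nothing of Bałaban's asserted.  BY-NAME EFFECT ON THE WALL: NONE.  NE7b NOT PRINTED ∕ NOT PROVED; spine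
PROVED 0∕9; rung (B)+1 — the programme's measures remain FINITE-torus statements; NOT the mass gap, NOT Clay.  HONEST DEPENDENCY: continuum YM
on T⁴ ⇐ BetaPertH ∧ nine spine estimates (0∕9 proved); BetaPertH ⇐ (D1) ∧ (D4) ∧ CAP+tail; G-an2-4 gates asym, D1 and NE2∕3∕4.
-/

set_option autoImplicit false

noncomputable section

namespace Summit.QuantumFields.BalabanUV.T4Continuum.NE7b.SupZdKernelInverseCubeRate

open Real Filter Topology
open scoped ENNReal
open Literature.MathematicalPhysics.QuantumFieldTheory.Balaban1983to89
open B6QGQLower276 (X)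
open SupZdExponentialSums (summable_exp_l1 tsum_exp_l1_le)
open SupZdCoarseForm (natAbs_sub_comm_sum)
open SupZdCoarseInverse (l1_triangle)
open SupZdKernelInverseLipschitz (inverse_lipschitz)

variable {d : ℕ}

/-! ## §1. The exponential tail outside an `ℓ¹`-ball -/

/-- **TAIL**: `Σ′_{|c|₁ > R}e^{−ν|b−c|₁} ≤ K_{ν∕2}·e^{−(ν∕2)(R − |b|₁)}` — on the tail `|b − c|₁ ≥ |c|₁ − |b|₁ > R − |b|₁`, so half the rate pays
the distance to the tail and the other half is summed by (189). [folklore] -/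
theorem tail_exp_sum {ν : ℝ} (hν : 0 < ν) (b : X d) (R : ℝ) :
    Summable (fun c : X d => exp (-(ν * ∑ i, (((b i - c i).natAbs : ℕ) : ℝ)))
      * (if R < ∑ i, (((c i - (0 : X d) i).natAbs : ℕ) : ℝ) then (1 : ℝ) else 0)) ∧
    ∑' c : X d, exp (-(ν * ∑ i, (((b i - c i).natAbs : ℕ) : ℝ)))
      * (if R < ∑ i, (((c i - (0 : X d) i).natAbs : ℕ) : ℝ) then (1 : ℝ) else 0)
      ≤ (2 * (1 - exp (-(ν / 2)))⁻¹) ^ d * exp (-(ν / 2 * (R - ∑ i, (((b i - (0 : X d) i).natAbs : ℕ) : ℝ)))) := by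
  have hν2 : 0 < ν / 2 := by linarith
  have hpt : ∀ c : X d, exp (-(ν * ∑ i, (((b i - c i).natAbs : ℕ) : ℝ)))
      * (if R < ∑ i, (((c i - (0 : X d) i).natAbs : ℕ) : ℝ) then (1 : ℝ) else 0)
      ≤ exp (-(ν / 2 * (R - ∑ i, (((b i - (0 : X d) i).natAbs : ℕ) : ℝ)))) * exp (-(ν / 2 * ∑ i, (((b i - c i).natAbs : ℕ) : ℝ))) := by
    intro c
    split_ifs with h
    · rw [mul_one, ← exp_add]
      refine exp_le_exp.2 ?_
      have htri := l1_triangle c b (0 : X d)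
      rw [natAbs_sub_comm_sum c b] at htri
      nlinarith
    · rw [mul_zero]; positivity
  have hs2 : Summable fun c : X d => exp (-(ν / 2 * (R - ∑ i, (((b i - (0 : X d) i).natAbs : ℕ) : ℝ))))
      * exp (-(ν / 2 * ∑ i, (((b i - c i).natAbs : ℕ) : ℝ))) := (summable_exp_l1 hν2 b).mul_left _
  have hs1 : Summable (fun c : X d => exp (-(ν * ∑ i, (((b i - c i).natAbs : ℕ) : ℝ)))
      * (if R < ∑ i, (((c i - (0 : X d) i).natAbs : ℕ) : ℝ) then (1 : ℝ) else 0)) :=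
    Summable.of_nonneg_of_le (fun c => by positivity) hpt hs2
  refine ⟨hs1, (hs1.tsum_le_tsum hpt hs2).trans ?_⟩
  rw [tsum_mul_left, mul_comm]
  exact mul_le_mul_of_nonneg_right (tsum_exp_l1_le hν2 b) (exp_pos _).le

/-! ## §2. THE END: agreement on an `ℓ¹`-ball gives an exponential rate in the margin -/

/-- **HEADLINE — INVERSES OF KERNELS THAT AGREE ON A BALL AGREE UP TO THE MARGIN**: `A, B` bounded kernels on `ℤ^d` (`|A|, |B| ≤ C_A`),
`N_A` a decaying left inverse of `A`, `N_B` a decaying right inverse of `B` (`|N_·(b,c)| ≤ C_Ne^{−ν|b−c|₁}`), and `|B(c,c′) − A(c,c′)| ≤ ε`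
whenever BOTH `|c|₁, |c′|₁ ≤ R` ⟹ `|N_A(b,b′) − N_B(b,b′)| ≤ C_N²K_ν·(εK_ν + 2C_AK_{ν∕2}(e^{−(ν∕2)(R − |b|₁)} + e^{−(ν∕2)(R − |b′|₁)}))` — (228)'s
weighted Lipschitz bound with the weight `ε + 2C_A(𝟙[|c|₁ > R] + 𝟙[|c′|₁ > R])` and §1's tail.  The torus → `ℤ^d` template: a transplanted
torus coarse operator AGREES with `T_K` on the bulk of the window ((196)'s data agreement, `ε` = the seam leakage), so its inverse is
`e^{−(ν∕2)·margin}`-close to `N_K` at fixed `(b, b′)`. [folklore] -/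
theorem inverse_ball_rate {CA Cn ν ε R : ℝ} (hCA : 0 ≤ CA) (hCn : 0 ≤ Cn) (hν : 0 < ν) (hε : 0 ≤ ε) (A B NA NB : X d → X d → ℝ)
    (hA : ∀ c c', |A c c'| ≤ CA) (hB : ∀ c c', |B c c'| ≤ CA)
    (hNA : ∀ b c, |NA b c| ≤ Cn * exp (-(ν * ∑ i, (((b i - c i).natAbs : ℕ) : ℝ))))
    (hNB : ∀ b c, |NB b c| ≤ Cn * exp (-(ν * ∑ i, (((b i - c i).natAbs : ℕ) : ℝ))))
    (hNAA : ∀ b c', ∑' c : X d, NA b c * A c c' = if b = c' then 1 else 0)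
    (hBNB : ∀ c b', ∑' c' : X d, B c c' * NB c' b' = if c = b' then 1 else 0)
    (hagree : ∀ c c' : X d, ∑ i, (((c i - (0 : X d) i).natAbs : ℕ) : ℝ) ≤ R → ∑ i, (((c' i - (0 : X d) i).natAbs : ℕ) : ℝ) ≤ R →
      |B c c' - A c c'| ≤ ε) (b b' : X d) :
    |NA b b' - NB b b'| ≤ Cn ^ 2 * (2 * (1 - exp (-ν))⁻¹) ^ d
      * (ε * (2 * (1 - exp (-ν))⁻¹) ^ d + 2 * CA * (2 * (1 - exp (-(ν / 2)))⁻¹) ^ d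
        * (exp (-(ν / 2 * (R - ∑ i, (((b i - (0 : X d) i).natAbs : ℕ) : ℝ))))
          + exp (-(ν / 2 * (R - ∑ i, (((b' i - (0 : X d) i).natAbs : ℕ) : ℝ)))))) := by
  classical
  have hν2 : 0 < ν / 2 := by linarith
  have hKν : 0 ≤ (2 * (1 - exp (-ν))⁻¹) ^ d :=
    pow_nonneg (mul_nonneg zero_le_two (inv_nonneg.2 (sub_nonneg.2 (exp_le_one_iff.2 (by linarith))))) d
  have hKν2 : 0 ≤ (2 * (1 - exp (-(ν / 2)))⁻¹) ^ d :=
    pow_nonneg (mul_nonneg zero_le_two (inv_nonneg.2 (sub_nonneg.2 (exp_le_one_iff.2 (by linarith))))) d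
  -- the weight: `ε` on the ball pair, `+ 2C_A` for each index outside the ball
  obtain ⟨χ, hχ⟩ : ∃ χ : X d → ℝ, ∀ c, χ c = if R < ∑ i, (((c i - (0 : X d) i).natAbs : ℕ) : ℝ) then (1 : ℝ) else 0 := ⟨_, fun _ => rfl⟩
  have hχ0 : ∀ c, 0 ≤ χ c := fun c => by rw [hχ]; split_ifs <;> norm_num
  have hχ1 : ∀ c, χ c ≤ 1 := fun c => by rw [hχ]; split_ifs <;> norm_num
  obtain ⟨w, hw⟩ : ∃ w : X d → X d → ℝ, ∀ c c', w c c' = ε + 2 * CA * (χ c + χ c') := ⟨_, fun _ _ => rfl⟩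
  have hdiff : ∀ c c', |B c c' - A c c'| ≤ 2 * CA := fun c c' => (abs_sub _ _).trans (by linarith [hA c c', hB c c'])
  have hwdom : ∀ c c', |B c c' - A c c'| ≤ w c c' := by
    intro c c'
    rw [hw]
    have hp1 : 0 ≤ 2 * CA * χ c := mul_nonneg (by positivity) (hχ0 c)
    have hp2 : 0 ≤ 2 * CA * χ c' := mul_nonneg (by positivity) (hχ0 c')
    by_cases h1 : R < ∑ i, (((c i - (0 : X d) i).natAbs : ℕ) : ℝ)
    · have hc1 : χ c = 1 := by rw [hχ, if_pos h1]
      have hd := hdiff c c'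
      rw [hc1] at hp1 ⊢
      linarith
    by_cases h2 : R < ∑ i, (((c' i - (0 : X d) i).natAbs : ℕ) : ℝ)
    · have hc2 : χ c' = 1 := by rw [hχ, if_pos h2]
      have hd := hdiff c c'
      rw [hc2] at hp2 ⊢
      linarith
    · have h := hagree c c' (not_lt.1 h1) (not_lt.1 h2)
      linarith
  -- the three pieces of the weighted double series
  obtain ⟨eb, heb⟩ : ∃ eb : X d → ℝ, ∀ c, eb c = exp (-(ν * ∑ i, (((b i - c i).natAbs : ℕ) : ℝ))) := ⟨_, fun _ => rfl⟩
  obtain ⟨eb', heb'⟩ : ∃ eb' : X d → ℝ, ∀ c', eb' c' = exp (-(ν * ∑ i, (((b' i - c' i).natAbs : ℕ) : ℝ))) := ⟨_, fun _ => rfl⟩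
  have hse : Summable eb := (summable_exp_l1 hν b).congr fun c => by rw [heb]
  have hse' : Summable eb' := (summable_exp_l1 hν b').congr fun c' => by rw [heb']
  have hSe : ∑' c, eb c ≤ (2 * (1 - exp (-ν))⁻¹) ^ d := by simp only [heb]; exact tsum_exp_l1_le hν b
  have hSe' : ∑' c', eb' c' ≤ (2 * (1 - exp (-ν))⁻¹) ^ d := by simp only [heb']; exact tsum_exp_l1_le hν b'
  have heb0 : ∀ c, 0 ≤ eb c := fun c => by rw [heb]; positivity
  have heb'0 : ∀ c', 0 ≤ eb' c' := fun c' => by rw [heb']; positivity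
  obtain ⟨hsχ, hTχ⟩ := tail_exp_sum (d := d) hν b R
  obtain ⟨hsχ', hTχ'⟩ := tail_exp_sum (d := d) hν b' R
  have hsχb : Summable fun c => eb c * χ c := hsχ.congr fun c => by rw [heb, hχ]
  have hsχb' : Summable fun c' => eb' c' * χ c' := hsχ'.congr fun c' => by rw [heb', hχ]
  have hTχb : ∑' c, eb c * χ c ≤ (2 * (1 - exp (-(ν / 2)))⁻¹) ^ d
      * exp (-(ν / 2 * (R - ∑ i, (((b i - (0 : X d) i).natAbs : ℕ) : ℝ)))) := by
    have e : (fun c => eb c * χ c) = fun c : X d => exp (-(ν * ∑ i, (((b i - c i).natAbs : ℕ) : ℝ)))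
        * (if R < ∑ i, (((c i - (0 : X d) i).natAbs : ℕ) : ℝ) then (1 : ℝ) else 0) := funext fun c => by rw [heb, hχ]
    rw [e]; exact hTχ
  have hTχb' : ∑' c', eb' c' * χ c' ≤ (2 * (1 - exp (-(ν / 2)))⁻¹) ^ d
      * exp (-(ν / 2 * (R - ∑ i, (((b' i - (0 : X d) i).natAbs : ℕ) : ℝ)))) := by
    have e : (fun c' => eb' c' * χ c') = fun c' : X d => exp (-(ν * ∑ i, (((b' i - c' i).natAbs : ℕ) : ℝ)))
        * (if R < ∑ i, (((c' i - (0 : X d) i).natAbs : ℕ) : ℝ) then (1 : ℝ) else 0) := funext fun c' => by rw [heb', hχ]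
    rw [e]; exact hTχ'
  -- summability of the three product families on `ℤ^d × ℤ^d`
  obtain ⟨f1, hf1⟩ : ∃ f1 : X d → ℝ, ∀ c, f1 c = eb c * ε := ⟨_, fun _ => rfl⟩
  obtain ⟨f2, hf2⟩ : ∃ f2 : X d → ℝ, ∀ c, f2 c = eb c * χ c * (2 * CA) := ⟨_, fun _ => rfl⟩
  obtain ⟨f3, hf3⟩ : ∃ f3 : X d → ℝ, ∀ c, f3 c = eb c * (2 * CA) := ⟨_, fun _ => rfl⟩
  obtain ⟨g3, hg3⟩ : ∃ g3 : X d → ℝ, ∀ c', g3 c' = eb' c' * χ c' := ⟨_, fun _ => rfl⟩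
  have hf1s : Summable f1 := (hse.mul_right ε).congr fun c => by rw [hf1]
  have hf2s : Summable f2 := (hsχb.mul_right (2 * CA)).congr fun c => by rw [hf2]
  have hf3s : Summable f3 := (hse.mul_right (2 * CA)).congr fun c => by rw [hf3]
  have hg3s : Summable g3 := hsχb'.congr fun c' => by rw [hg3]
  have hf10 : 0 ≤ f1 := fun c => by rw [Pi.zero_apply, hf1]; exact mul_nonneg (heb0 c) hε
  have hf20 : 0 ≤ f2 := fun c => by
    rw [Pi.zero_apply, hf2]; exact mul_nonneg (mul_nonneg (heb0 c) (hχ0 c)) (by positivity)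
  have hf30 : 0 ≤ f3 := fun c => by rw [Pi.zero_apply, hf3]; exact mul_nonneg (heb0 c) (by positivity)
  have hg30 : 0 ≤ g3 := fun c' => by rw [Pi.zero_apply, hg3]; exact mul_nonneg (heb'0 c') (hχ0 c')
  have heb'0' : 0 ≤ eb' := fun c' => by rw [Pi.zero_apply]; exact heb'0 c'
  have hP1 : Summable fun x : X d × X d => f1 x.1 * eb' x.2 := hf1s.mul_of_nonneg hse' hf10 heb'0'
  have hP2 : Summable fun x : X d × X d => f2 x.1 * eb' x.2 := hf2s.mul_of_nonneg hse' hf20 heb'0'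
  have hP3 : Summable fun x : X d × X d => f3 x.1 * g3 x.2 := hf3s.mul_of_nonneg hg3s hf30 hg30
  have hsplit : ∀ x : X d × X d, eb x.1 * w x.1 x.2 * eb' x.2
      = f1 x.1 * eb' x.2 + (f2 x.1 * eb' x.2 + f3 x.1 * g3 x.2) := fun x => by
    rw [hw, hf1, hf2, hf3, hg3]; ring
  have hWs : Summable fun x : X d × X d => eb x.1 * w x.1 x.2 * eb' x.2 := (hP1.add (hP2.add hP3)).congr fun x => (hsplit x).symm
  -- (228) (i) with this weight
  obtain ⟨hgen, -⟩ := inverse_lipschitz (d := d) hCA hCn hν A B NA NB hA hB hNA hNB hNAA hBNB b b'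
  have hWs' : Summable fun x : X d × X d => exp (-(ν * ∑ i, (((b i - x.1 i).natAbs : ℕ) : ℝ))) * w x.1 x.2
      * exp (-(ν * ∑ i, (((b' i - x.2 i).natAbs : ℕ) : ℝ))) := hWs.congr fun x => by rw [heb, heb']
  have h := hgen w hwdom hWs'
  have hev : ∑' x : X d × X d, exp (-(ν * ∑ i, (((b i - x.1 i).natAbs : ℕ) : ℝ))) * w x.1 x.2
      * exp (-(ν * ∑ i, (((b' i - x.2 i).natAbs : ℕ) : ℝ)))
      = (∑' c, eb c) * ε * (∑' c', eb' c') + ((∑' c, eb c * χ c) * (2 * CA) * (∑' c', eb' c')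
        + (∑' c, eb c) * (2 * CA) * (∑' c', eb' c' * χ c')) := by
    have e0 : (fun x : X d × X d => exp (-(ν * ∑ i, (((b i - x.1 i).natAbs : ℕ) : ℝ))) * w x.1 x.2
        * exp (-(ν * ∑ i, (((b' i - x.2 i).natAbs : ℕ) : ℝ))))
        = fun x => f1 x.1 * eb' x.2 + (f2 x.1 * eb' x.2 + f3 x.1 * g3 x.2) :=
      funext fun x => by rw [← hsplit x, heb, heb']
    have t1 : ∑' x : X d × X d, f1 x.1 * eb' x.2 = (∑' c, eb c) * ε * (∑' c', eb' c') := by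
      rw [← hf1s.tsum_mul_tsum hse' hP1]; simp only [hf1]; rw [tsum_mul_right]
    have t2 : ∑' x : X d × X d, f2 x.1 * eb' x.2 = (∑' c, eb c * χ c) * (2 * CA) * (∑' c', eb' c') := by
      rw [← hf2s.tsum_mul_tsum hse' hP2]; simp only [hf2]; rw [tsum_mul_right]
    have t3 : ∑' x : X d × X d, f3 x.1 * g3 x.2 = (∑' c, eb c) * (2 * CA) * (∑' c', eb' c' * χ c') := by
      rw [← hf3s.tsum_mul_tsum hg3s hP3]; simp only [hf3, hg3]; rw [tsum_mul_right]
    rw [e0, hP1.tsum_add (hP2.add hP3), hP2.tsum_add hP3, t1, t2, t3]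
  rw [hev] at h
  refine h.trans ?_
  have hS1 : 0 ≤ ∑' c, eb c := tsum_nonneg heb0
  have hS2 : 0 ≤ ∑' c', eb' c' := tsum_nonneg heb'0
  have hS3 : 0 ≤ ∑' c, eb c * χ c := tsum_nonneg fun c => mul_nonneg (heb0 c) (hχ0 c)
  have hS4 : 0 ≤ ∑' c', eb' c' * χ c' := tsum_nonneg fun c' => mul_nonneg (heb'0 c') (hχ0 c')
  have hE1 : (∑' c, eb c) * ε * (∑' c', eb' c') ≤ (2 * (1 - exp (-ν))⁻¹) ^ d * ε * (2 * (1 - exp (-ν))⁻¹) ^ d :=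
    mul_le_mul (mul_le_mul_of_nonneg_right hSe hε) hSe' hS2 (by positivity)
  have hE2 : (∑' c, eb c * χ c) * (2 * CA) * (∑' c', eb' c')
      ≤ ((2 * (1 - exp (-(ν / 2)))⁻¹) ^ d * exp (-(ν / 2 * (R - ∑ i, (((b i - (0 : X d) i).natAbs : ℕ) : ℝ))))) * (2 * CA)
        * (2 * (1 - exp (-ν))⁻¹) ^ d :=
    mul_le_mul (mul_le_mul_of_nonneg_right hTχb (by positivity)) hSe' hS2 (by positivity)
  have hE3 : (∑' c, eb c) * (2 * CA) * (∑' c', eb' c' * χ c')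
      ≤ (2 * (1 - exp (-ν))⁻¹) ^ d * (2 * CA)
        * ((2 * (1 - exp (-(ν / 2)))⁻¹) ^ d * exp (-(ν / 2 * (R - ∑ i, (((b' i - (0 : X d) i).natAbs : ℕ) : ℝ))))) :=
    mul_le_mul (mul_le_mul_of_nonneg_right hSe (by positivity)) hTχb' hS4 (by positivity)
  calc Cn ^ 2 * ((∑' c, eb c) * ε * (∑' c', eb' c') + ((∑' c, eb c * χ c) * (2 * CA) * (∑' c', eb' c')
        + (∑' c, eb c) * (2 * CA) * (∑' c', eb' c' * χ c')))
      ≤ Cn ^ 2 * ((2 * (1 - exp (-ν))⁻¹) ^ d * ε * (2 * (1 - exp (-ν))⁻¹) ^ d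
        + (((2 * (1 - exp (-(ν / 2)))⁻¹) ^ d * exp (-(ν / 2 * (R - ∑ i, (((b i - (0 : X d) i).natAbs : ℕ) : ℝ))))) * (2 * CA)
            * (2 * (1 - exp (-ν))⁻¹) ^ d
          + (2 * (1 - exp (-ν))⁻¹) ^ d * (2 * CA)
            * ((2 * (1 - exp (-(ν / 2)))⁻¹) ^ d * exp (-(ν / 2 * (R - ∑ i, (((b' i - (0 : X d) i).natAbs : ℕ) : ℝ))))))) :=
        mul_le_mul_of_nonneg_left (add_le_add hE1 (add_le_add hE2 hE3)) (by positivity)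
    _ = _ := by ring

/-! ## §3. Toy -/

/-- Toy (`d = 2`, `ν = 2`, `R = 3` at the origin): the tail outside the `ℓ¹`-ball of radius `3` is at most `K_1·e^{−3}`. -/
example : ∑' c : X 2, exp (-(2 * ∑ i, ((((0 : X 2) i - c i).natAbs : ℕ) : ℝ)))
      * (if (3 : ℝ) < ∑ i, (((c i - (0 : X 2) i).natAbs : ℕ) : ℝ) then (1 : ℝ) else 0)
    ≤ (2 * (1 - exp (-(2 / 2)))⁻¹) ^ 2 * exp (-(2 / 2 * (3 - ∑ i, ((((0 : X 2) i - (0 : X 2) i).natAbs : ℕ) : ℝ)))) :=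
  (tail_exp_sum (d := 2) two_pos 0 3).2

end Summit.QuantumFields.BalabanUV.T4Continuum.NE7b.SupZdKernelInverseCubeRate
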